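import Mathlib
import Summits.Ventures.HodgeRepro2.BallQuotientHolomorphicDescent
import Summits.Ventures.HodgeRepro2.BallIdentityPrinciple

/-!
# Holomorphic functions on a compact `Γ\𝔹²` are constant

Kernel annex of the blind cell `pub-hodge-repro2` (seat p2), Tier-3 hypothesis shapes of
`Hypothesis.lean`.  The closer of the brief lives on a COMPACT quotient `Γ\𝔹²` (anisotropic `H`,
Sh79 §4 / DR15 §2 — compactness is the arithmetic input and is taken here as a HYPOTHESIS
`[CompactSpace (ballQuotient hQ S hS)]`, not proved).  For the complex-manifold structure of
`BallQuotientComplexManifold.lean`: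

* `connectedSpace_ballQuotient`: `Γ\𝔹²` is connected (the ball is convex, the quotient map
  continuous and surjective);
* **`apply_eq_of_compactSpace_ballQuotient`**: on a compact `Γ\𝔹²` every holomorphic map to a
  complex normed space is constant (Mathlib's maximum principle on compact connected complex
  manifolds, `MDifferentiable.apply_eq_of_compactSpace`);
* **`eq_of_compactSpace_of_invariant`**: hence every `Γ`-invariant holomorphic function on the
  ball is constant once `Γ\𝔹²` is compact — no non-constant automorphic forms of weight `0`,
  the degree-0 shadow of «`H⁰(Γ\𝔹², 𝒪) = ℂ`» used in the transfer's Hodge-theoretic bookkeeping.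
-/

namespace Summit.Ventures.HodgeRepro2.ShimuraData

open scoped ContDiff Manifold
open Topology Filter

variable {K : Type*} [Field K] [NumberField K] [NumberField.IsCMField K]
  {τ₁ : K →+* ℂ} {H : Matrix (Fin 3) (Fin 3) K} {Q : Matrix (Fin 3) (Fin 3) ℂ}
  (hQ : IsFrame K τ₁ H Q) (S : Subgroup (GL (Fin 3) K))
  (hS : (S : Set (GL (Fin 3) K)) ⊆ (unitaryGroup K H : Set (GL (Fin 3) K)))

/-- The ball is a connected space. -/
instance ball₂.instConnectedSpace : ConnectedSpace ball₂ :=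
  isConnected_iff_connectedSpace.1 isConnected_ball₂

/-- `Γ\𝔹²` is connected: the continuous surjective image of the connected ball. -/
theorem connectedSpace_ballQuotient : ConnectedSpace (ballQuotient hQ S hS) :=
  (ballQuotient_mk_surjective hQ S hS).connectedSpace
    (isOpenQuotientMap_ballQuotient_mk hQ S hS).continuous

/-- `Γ\𝔹²` is preconnected. -/
theorem preconnectedSpace_ballQuotient : PreconnectedSpace (ballQuotient hQ S hS) :=
  (connectedSpace_ballQuotient hQ S hS).toPreconnectedSpace

section compact

variable {F : Type*} [NormedAddCommGroup F] [NormedSpace ℂ F]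

/-- **Holomorphic maps on a compact `Γ\𝔹²` are constant** (for the atlas pushed forward along
the quotient map; compactness of the quotient is a hypothesis). -/
theorem apply_eq_of_compactSpace_ballQuotient (hf : IsLocalHomeomorph (ballQuotient.mk hQ S hS))
    [CompactSpace (ballQuotient hQ S hS)] {φ : ballQuotient hQ S hS → F}
    (hφ : @ContMDiff ℂ _ (Fin 2 → ℂ) _ _ (Fin 2 → ℂ) _ 𝓘(ℂ, Fin 2 → ℂ) (ballQuotient hQ S hS) _
      (ballQuotientChartedSpace hQ S hS hf) F _ _ F _ 𝓘(ℂ, F) F _ _ ω φ)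
    (a b : ballQuotient hQ S hS) : φ a = φ b := by
  letI := ballQuotientChartedSpace hQ S hS hf
  haveI : IsManifold 𝓘(ℂ, Fin 2 → ℂ) ω (ballQuotient hQ S hS) := isManifold_ballQuotient hQ S hS hf
  haveI : IsManifold 𝓘(ℂ, Fin 2 → ℂ) 1 (ballQuotient hQ S hS) := IsManifold.of_le (n := ω) le_top
  haveI := preconnectedSpace_ballQuotient hQ S hS
  exact (hφ.mdifferentiable (by simp)).apply_eq_of_compactSpace (I := 𝓘(ℂ, Fin 2 → ℂ)) a b

/-- On a compact `Γ\𝔹²`, every holomorphic map is a constant function. -/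
theorem exists_eq_const_of_compactSpace_ballQuotient
    (hf : IsLocalHomeomorph (ballQuotient.mk hQ S hS)) [CompactSpace (ballQuotient hQ S hS)]
    {φ : ballQuotient hQ S hS → F}
    (hφ : @ContMDiff ℂ _ (Fin 2 → ℂ) _ _ (Fin 2 → ℂ) _ 𝓘(ℂ, Fin 2 → ℂ) (ballQuotient hQ S hS) _
      (ballQuotientChartedSpace hQ S hS hf) F _ _ F _ 𝓘(ℂ, F) F _ _ ω φ) :
    ∃ v : F, φ = Function.const _ v := by
  obtain ⟨a⟩ := (connectedSpace_ballQuotient hQ S hS).toNonempty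
  exact ⟨φ a, funext fun b => apply_eq_of_compactSpace_ballQuotient hQ S hS hf hφ b a⟩

/-- **`Γ`-invariant holomorphic functions on the ball are constant when `Γ\𝔹²` is compact**:
there are no non-constant automorphic forms of weight `0`. -/
theorem eq_of_compactSpace_of_invariant (hf : IsLocalHomeomorph (ballQuotient.mk hQ S hS))
    [CompactSpace (ballQuotient hQ S hS)] {ψ : ball₂ → F}
    (hψ : ContMDiff 𝓘(ℂ, Fin 2 → ℂ) 𝓘(ℂ, F) ω ψ)
    (hinv : letI := frameAction hQ S hS; ∀ (γ : S) (z : ball₂), ψ (γ • z) = ψ z) (z w : ball₂) :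
    ψ z = ψ w := by
  have h := apply_eq_of_compactSpace_ballQuotient hQ S hS hf
    (contMDiff_ballQuotientLift hQ S hS hf hψ hinv) (ballQuotient.mk hQ S hS z)
    (ballQuotient.mk hQ S hS w)
  simpa using h

end compact

end Summit.Ventures.HodgeRepro2.ShimuraData
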